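/-
Copyright (c) 2026 the pub-hodgecm-mathlib formalisation cell (harness21).  Prover seat hodgecm-mathlib-K2E3-p37 (g2), Track B «K2-LIT» ∕ h413 =
`stmt-HodgeConjecture-24833`, line `K2_E3_EllipticInputs`, unit U4 «Keys», PART «U4Keys» socket :182 (U4f-χ₁-ram-one-pos)
`sig_K2E3KeysThmTwoContractingRamifiedCharOnePosDepth` (L4 line-lead K2E3-plan (g5); regime A_pos over the two-depth group; brick (B1b) of this seat's memo
`K2/K2E3-p37/g2/MEMO-PosA-Recut.K2E3-p37-g2.md`): «EXACT CONDUCTORS AND ROCHE EXPONENTS» — from a smoothness level `N` of `χ₁`, the positive-depth witness of :182 and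
the Branch-A witness, extract cond_E `= m + 1 ≥ 2` and cond_F `= k + 1 ≥ 1` with exact witnesses and the aligned two-depth exponents
`(r₁, s₁; r₂, s₂) = (⌊(m+1)∕2⌋, ⌊(k+1)∕2⌋; ⌈(m+1)∕2⌉, ⌈(k+1)∕2⌉)` together with every arithmetic side condition of ★ p862713 ∕ ★ p862772 ∕ ★ p862449.
REPORT-FIRST 2026-09-04.
-/
import Summits.HodgeConjecture.HodgeConjecture.Theorems.K2E3LevelNDepthWitnessCover   -- ★ p862085: `v_le_of_lt_one` (discreteness `|a| < 1 ⟹ |a| ≤ |ϖ|`)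
import Literature.NumberTheory.Automorphic.AnisotropicUnitaryGroupCompactOfPlace     -- ★ `conjLocal_apply_eq_of_smul_eq` (the CM local ring `LocalRing L v`, `conjLocal`, `PlacesOver`)
import Literature.NumberTheory.Automorphic.UnitaryGroupInertPlaceHyperbolicBasis     -- ★ `galAdicCompletionMap_galAdicCompletionMap_of_smul_eq` (`σ_w σ_w = 1`)
import HarnessLib

/-!
# K2 ∕ E3 «EllipticInputs», unit U4 «Keys» — (U4f-χ₁-ram-one-pos), regime A_pos: EXACT CONDUCTORS AND THE ROCHE EXPONENTS (brick (B1b))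
# «smooth `χ₁` of positive depth, non-trivial on a `σ`-fixed unit ⟹ cond_E `= m+1 ≥ 2`, cond_F `= k+1`, `k ≤ m`, exact witnesses, and `(⌊n∕2⌋, ⌊c∕2⌋; ⌈n∕2⌉, ⌈c∕2⌉)` with all side conditions»
# [Roche1998 §3; MoyPrasad1996 §3; BushnellHenniart2006 §1.5]

Cell hodgecm-mathlib, Track B «K2-LIT», crux item H413 = stmt-HodgeConjecture-24833 (route `HCCMUnconditional`, no route verbs); target BY NAME the OPEN tier-0 leaf
`…K2E3EllipticInputs.U4Keys.sig_K2E3KeysThmTwoContractingRamifiedCharOnePosDepth` (U4Keys ED. 8 :182).  Author K2E3-p37 (g2).  `--supports stmt-HodgeConjecture-24833 --as helper`;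
THEOREMS ONLY; CM level, frame-light (a place `w ∣ v` and a uniformiser `ϖ` of `L_w` only).  NOT THE PAYER.

THE POINT.  The A_pos assembly over Roche's `J_e` (bricks ★ D174, ★ p862449∕p862709, ★ p862537∕p862590, ★ p862593∕p862713∕p862772∕p862617, …) is stated over LETTERS: `hcond`
(cond_E `≤ m + 1`), `hcondF` (cond_F `≤ k + 1` on `σ`-fixed units), exact witnesses `u₁` (depth `m`), `u₂` (`σ`-fixed, depth `k`), and exponents `(r₁, s₁; r₂, s₂)` with
`r₁ + r₂ = m + 1`, `s₁ + s₂ = k + 1`, `|r₁ − r₂| ≤ 1`, `|s₁ − s₂| ≤ 1`, aligned, `k ≤ m`, `1 ≤ m`, and ★ p862449's `m + 1 ≤ r₁ + r₂`, `m + 1 ≤ 2r₁ + s₂`, `m + 1 ≤ s₁ + 2r₂`,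
`k + 1 ≤ s₁ + s₂`.  The socket :182 gives none of these; it gives `h₁ : Continuous χ₁`, `hpos` (positive depth) and — in Branch A — `hA` (`χ₁(u·σu) ≠ 1` for a unit-valued `u`).
This file does the BOOKKEEPING half (B1b): from a SMOOTHNESS LEVEL `hsmooth : ∃ N, χ₁ = 1 on {u : ∀ w′, |u_{w′} − 1| ≤ |ϖ|^N}` (the topological half (B1a) «continuous ⟹
smooth» is a separate brick: ★ `isOpen_ker_of_isCompact_isOpen_subgroup`-type), `hpos` and `hA`, produce ALL the letters at once by `Nat.find` (cond_E: the least level killing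
every unit, `≥ 2` by `hpos` and discreteness; cond_F: the least level killing every `σ`-FIXED unit, `≥ 1` by `hA` — `u·σu` is `σ`-fixed and integral; `≤` cond_E trivially),
and the Roche exponents with every side condition discharged by `omega`.
* §1 **`exists_conductors_and_exponents`**.
HONEST LABEL: HC_CM is proved only modulo the 7 printed citations (2 remaining named inputs: hLiu418 = stmt-HodgeConjecture-24832, h413 = stmt-HodgeConjecture-24833)
until rung 0 closes; count-neutral — this file does NOT pay the leaf; no printed citation is discharged.

## References
* [Roche1998] A. Roche, *Types and Hecke algebras for principal series representations of split reductive p-adic groups*, Ann. Sci. ÉNS (4) 31 (1998), §3 (the function `f_χ`).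
* [MoyPrasad1996] A. Moy, G. Prasad, *Jacquet functors and unrefined minimal K-types*, Comment. Math. Helv. 71 (1996), §3 (depth).
* [BushnellHenniart2006] C. J. Bushnell, G. Henniart, *The Local Langlands Conjecture for GL(2)*, Grundlehren 335 (2006), §1.5 (smooth characters, level).
-/

set_option autoImplicit false
-- the mandated namespace repeats the single-problem summit's segment (`HodgeConjecture.HodgeConjecture`)
set_option linter.dupNamespace false

noncomputable section

open NumberField IsDedekindDomain
open scoped WithZero Valued
open Literature.NumberTheory Literature.NumberTheory.Automorphic Literature.NumberTheory.Automorphic.UnitaryGroup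

namespace Summit.HodgeConjecture.HodgeConjecture.Cruxes.H413.K2E3TwoDepthConductorExponents

open Summit.HodgeConjecture.HodgeConjecture.Cruxes.H413

variable (L : Type) [Field L] [NumberField L] [IsCMField L] (v : HeightOneSpectrum (𝓞 ↥(maximalRealSubfield L)))
  (w : PlacesOver L v) {ϖ : w.1.adicCompletion L} (hϖ : Valued.v ϖ = WithZero.exp (-1 : ℤ))

include hϖ in
/-- **EXACT CONDUCTORS AND ROCHE EXPONENTS (brick (B1b)).**  `χ₁ : (L ⊗ L⁺_v)ˣ → ℂˣ` smooth at some level `N` in the `ϖ`-adic congruence filtration read at every `w′ ∣ v`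
(`hsmooth`), of positive depth (`hpos`, :182's binder verbatim) and non-trivial on some unit-valued `u·σu` (`hA`, Branch A).  Then there are `m ≥ 1`, `k ≤ m` and aligned
two-depth exponents `(r₁, s₁; r₂, s₂)` (`r₁ + r₂ = m + 1`, `s₁ + s₂ = k + 1`, `|r₁ − r₂| ≤ 1`, `|s₁ − s₂| ≤ 1`, `r₁ ≤ r₂`, `s₁ ≤ s₂`, and ★ p862449's four concavity
inequalities) such that: `χ₁ = 1` at depth `m + 1` (`hcond`), `χ₁ = 1` on `σ`-fixed units at depth `k + 1` (`hcondF`), some `u₁` of depth `m` has `χ₁ u₁ ≠ 1` (cond_E `= m + 1`)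
and some `σ`-fixed `u₂` of depth `k` has `χ₁ u₂ ≠ 1` (cond_F `= k + 1`).  Pure bookkeeping (`Nat.find`, discreteness ★ `v_le_of_lt_one`, `omega`).
[cite: Roche1998, §3] [cite: MoyPrasad1996, §3] [cite: BushnellHenniart2006, §1.5] -/
theorem exists_conductors_and_exponents (χ₁ : (LocalRing L v)ˣ →* ℂˣ)
    (hsmooth : ∃ N : ℕ, ∀ u : (LocalRing L v)ˣ, (∀ w' : PlacesOver L v, Valued.v (((u : LocalRing L v) w') - 1) ≤ Valued.v ϖ ^ N) → χ₁ u = 1)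
    (hpos : ∃ u : (LocalRing L v)ˣ, (∀ w' : PlacesOver L v, Valued.v (((u : LocalRing L v) w') - 1) < 1) ∧ χ₁ u ≠ 1)
    (hA : ∃ u : (LocalRing L v)ˣ, (∀ w' : PlacesOver L v, Valued.v ((u : LocalRing L v) w') = 1) ∧
      χ₁ (u * Units.map (conjLocal L (IsCMField.complexConj L) v : LocalRing L v →* LocalRing L v) u) ≠ 1)
    (hns : ∀ w' : PlacesOver L v, IsCMField.complexConj L • w'.1 = w'.1) :
    ∃ m k r₁ s₁ r₂ s₂ : ℕ, 1 ≤ m ∧ k ≤ m ∧ r₁ + r₂ = m + 1 ∧ s₁ + s₂ = k + 1 ∧ r₁ ≤ r₂ + 1 ∧ r₂ ≤ r₁ + 1 ∧ s₁ ≤ s₂ + 1 ∧ s₂ ≤ s₁ + 1 ∧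
      (r₁ ≤ r₂ ∧ s₁ ≤ s₂) ∧ (m + 1 ≤ r₁ + r₂ ∧ m + 1 ≤ 2 * r₁ + s₂ ∧ m + 1 ≤ s₁ + 2 * r₂ ∧ k + 1 ≤ s₁ + s₂) ∧
      (∀ u : (LocalRing L v)ˣ, (∀ w' : PlacesOver L v, Valued.v (((u : LocalRing L v) w') - 1) ≤ Valued.v ϖ ^ (m + 1)) → χ₁ u = 1) ∧
      (∀ u : (LocalRing L v)ˣ, Units.map (conjLocal L (IsCMField.complexConj L) v : LocalRing L v →* LocalRing L v) u = u →
        (∀ w' : PlacesOver L v, Valued.v (((u : LocalRing L v) w') - 1) ≤ Valued.v ϖ ^ (k + 1)) → χ₁ u = 1) ∧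
      (∃ u₁ : (LocalRing L v)ˣ, (∀ w' : PlacesOver L v, Valued.v (((u₁ : LocalRing L v) w') - 1) ≤ Valued.v ϖ ^ m) ∧ χ₁ u₁ ≠ 1) ∧
      (∃ u₂ : (LocalRing L v)ˣ, Units.map (conjLocal L (IsCMField.complexConj L) v : LocalRing L v →* LocalRing L v) u₂ = u₂ ∧
        (∀ w' : PlacesOver L v, Valued.v (((u₂ : LocalRing L v) w') - 1) ≤ Valued.v ϖ ^ k) ∧ χ₁ u₂ ≠ 1) := by
  classical
  -- the two predicates «level `j` kills every unit» (`Q`) and «level `j` kills every `σ`-fixed unit» (`P`)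
  let Q : ℕ → Prop := fun j => ∀ u : (LocalRing L v)ˣ, (∀ w' : PlacesOver L v, Valued.v (((u : LocalRing L v) w') - 1) ≤ Valued.v ϖ ^ j) → χ₁ u = 1
  let P : ℕ → Prop := fun j => ∀ u : (LocalRing L v)ˣ, Units.map (conjLocal L (IsCMField.complexConj L) v : LocalRing L v →* LocalRing L v) u = u →
    (∀ w' : PlacesOver L v, Valued.v (((u : LocalRing L v) w') - 1) ≤ Valued.v ϖ ^ j) → χ₁ u = 1
  obtain ⟨N, hN⟩ := hsmooth
  have hQex : ∃ j, Q j := ⟨N, hN⟩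
  have hPex : ∃ j, P j := ⟨N, fun u _ hu => hN u hu⟩
  have hvϖ1 : Valued.v ϖ ≤ 1 := by rw [hϖ, ← WithZero.exp_zero, WithZero.exp_le_exp]; norm_num
  -- monotonicity in the level
  have hQmono : ∀ {j j' : ℕ}, j ≤ j' → Q j → Q j' := fun hjj hQ u hu =>
    hQ u fun w' => (hu w').trans (pow_le_pow_right_of_le_one' hvϖ1 hjj)
  have hPmono : ∀ {j j' : ℕ}, j ≤ j' → P j → P j' := fun hjj hP u hσu hu =>
    hP u hσu fun w' => (hu w').trans (pow_le_pow_right_of_le_one' hvϖ1 hjj)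
  -- `Q 1` fails (positive depth, discreteness)
  have hQ1 : ¬ Q 1 := by
    obtain ⟨u, hu, hχu⟩ := hpos
    refine fun h => hχu (h u fun w' => ?_)
    obtain rfl := PlacesOver.eq_of_smul_eq (IsCMField.complexConj L) (IsCMField.complexConj_ne_one L) w (hns w) w'
    rw [pow_one]
    exact K2E3LevelNDepthWitnessCover.v_le_of_lt_one hϖ (hu _)
  -- `σσ = 1` on `L ⊗ L⁺_v` (non-split: componentwise `σ_{w′} σ_{w′} = 1`)
  have hσσ : ∀ x : LocalRing L v, conjLocal L (IsCMField.complexConj L) v (conjLocal L (IsCMField.complexConj L) v x) = x := by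
    intro x
    funext w'
    rw [conjLocal_apply_eq_of_smul_eq (IsCMField.complexConj L) (IsCMField.complexConj_ne_one L) v w' (hns w'),
      conjLocal_apply_eq_of_smul_eq (IsCMField.complexConj L) (IsCMField.complexConj_ne_one L) v w' (hns w')]
    exact galAdicCompletionMap_galAdicCompletionMap_of_smul_eq (IsCMField.complexConj L) w' (IsCMField.complexConj_ne_one L) (hns w') (x w')
  -- `P 0` fails (Branch A: `u·σu` is a `σ`-fixed integral unit with `χ₁ ≠ 1`)
  have hP0 : ¬ P 0 := by
    obtain ⟨u, hu, hχu⟩ := hA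
    intro h
    refine hχu (h _ ?_ fun w' => ?_)
    · have hcc : Units.map (conjLocal L (IsCMField.complexConj L) v : LocalRing L v →* LocalRing L v)
          (Units.map (conjLocal L (IsCMField.complexConj L) v : LocalRing L v →* LocalRing L v) u) = u :=
        Units.ext (by simp only [Units.coe_map, MonoidHom.coe_coe]; exact hσσ _)
      rw [map_mul, hcc, mul_comm]
    · rw [pow_zero]
      refine (Valued.v.map_sub _ _).trans (max_le ?_ (by rw [Valuation.map_one]))
      rw [Units.val_mul, Pi.mul_apply, map_mul, hu w', one_mul, Units.coe_map, MonoidHom.coe_coe,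
        conjLocal_apply_eq_of_smul_eq (IsCMField.complexConj L) (IsCMField.complexConj_ne_one L) v w' (hns w'), valued_galAdicCompletionMap, hu w']
  -- the two conductors
  have hn2 : 2 ≤ Nat.find hQex := by
    by_contra h
    exact hQ1 (hQmono (by omega) (Nat.find_spec hQex))
  have hc1 : 1 ≤ Nat.find hPex := by
    by_contra h
    exact hP0 (hPmono (by omega) (Nat.find_spec hPex))
  have hcn : Nat.find hPex ≤ Nat.find hQex := Nat.find_min' hPex fun u _ hu => Nat.find_spec hQex u hu
  obtain ⟨m, hm⟩ : ∃ m, Nat.find hQex = m + 1 := ⟨Nat.find hQex - 1, by omega⟩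
  obtain ⟨k, hk⟩ : ∃ k, Nat.find hPex = k + 1 := ⟨Nat.find hPex - 1, by omega⟩
  -- exact witnesses below the conductors
  have hQm : ¬ Q m := Nat.find_min hQex (by omega)
  have hPk : ¬ P k := Nat.find_min hPex (by omega)
  obtain ⟨u₁, hu₁⟩ := not_forall.1 hQm
  obtain ⟨u₂, hu₂⟩ := not_forall.1 hPk
  rcases Classical.not_imp.1 hu₁ with ⟨hd₁, hχ₁⟩
  rcases Classical.not_imp.1 hu₂ with ⟨hσ₂, hu₂'⟩
  rcases Classical.not_imp.1 hu₂' with ⟨hd₂, hχ₂⟩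
  have hQspec : Q (m + 1) := hm ▸ Nat.find_spec hQex
  have hPspec : P (k + 1) := hk ▸ Nat.find_spec hPex
  refine ⟨m, k, (m + 1) / 2, (k + 1) / 2, m + 1 - (m + 1) / 2, k + 1 - (k + 1) / 2, by omega, by omega, by omega, by omega, by omega, by omega, by omega,
    by omega, ⟨by omega, by omega⟩, ⟨by omega, by omega, by omega, by omega⟩, hQspec, hPspec, ⟨u₁, hd₁, hχ₁⟩, ⟨u₂, hσ₂, hd₂, hχ₂⟩⟩

end Summit.HodgeConjecture.HodgeConjecture.Cruxes.H413.K2E3TwoDepthConductorExponents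

end
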